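import Literature.AlgebraicGeometry.AbelianSchemes.PolarizationHatLevelStructure
import Literature.AlgebraicGeometry.AbelianSchemes.LevelSectionsSubgroup
import HarnessLib

/-!
# The image `λ_* K` of a constant level subgroup under a polarisation acts freely on the dual abelian scheme

Layer `Literature/AlgebraicGeometry/AbelianSchemes`, namespace `Literature.AlgebraicGeometry.AbelianSchemes.AbelianSchemeOver`.
THEOREMS ONLY (no definition, no named fact, no instance, no notation, no `sorry`); over ★ `PolarizationHatLevelStructure`
(`Polarization.HasType.eq_one_of_pow_eq_one_of_comp_lam_eq_one`: a polarisation of type `δ` is injective on `d`-torsion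
geometric fibre points for `(∏ δᵢ, d) = 1`), ★ `LevelSectionsSubgroup` (`LevelStructure.restrict_ne_of_mem_iff`), ★
`LevelStructureOfIsogeny` (`restrict_comp`), ★ `AbelianSchemeConstSubgroupQuotient` (`forall_comp_translation_ne_of_forall_restrict_ne`).

Setting ([MumfordAV1970] §7 Thm. 4, §23; [MumfordFogartyKirwan1994] Ch. 7 §2 Def. 7.1, App. 7A): an abelian scheme `A/S`
with a dual pair `D = (Â, 𝒫)`, a polarisation `λ : A → Â` of type `δ`, a level-`n` structure `φ` on `A`, a subgroup
`K ≤ A(S)` enumerated through `φ` by an index set `K₀ ⊆ (ℤ/n)^{2g}` (`σ ∈ K ↔ ∃ c ∈ K₀, φ(c) = σ`) and killed by `d`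
with `(∏ δᵢ, d) = 1`, and its image `K′ := λ_* K = K.map (σ ↦ σ ≫ λ) ≤ Â(S)`.

* §1 **`restrict_comp_lam_ne_one_of_mem_iff`** — a section `σ ≠ 1` of `K` has `(σ ≫ λ)(s̄) ≠ 1` at EVERY geometric point
  `s̄` (`(σ ≫ λ)(s̄) = λ(σ(s̄))`, ★ `restrict_comp`; `σ(s̄)` is `d`-torsion and `λ` is injective on `d`-torsion points, ★
  `HasType.eq_one_of_pow_eq_one_of_comp_lam_eq_one`; and `σ(s̄) ≠ 1` by the basis clause, ★ `restrict_ne_of_mem_iff`);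
  **`eq_one_of_comp_lam_eq_one_of_mem_iff`** — `σ ≫ λ = 1 ⇒ σ = 1` on `K` once the base has a geometric point (so
  `σ ↦ σ ≫ λ` is injective on `K`, `injOn_comp_lam_of_mem_iff`, and the count `|λ_* K| = |K|`,
  `natCard_map_lam_eq_of_mem_iff` — the «`λ′` injective on `K`» input of the D6 package's `hcard`).
* §2 **`restrict_ne_of_mem_map_lam`** / **`translation_ne_of_mem_map_lam`** — the freeness clause `hfree′` of the (ii)-chain
  block for the dual-side subgroup `K′ = λ_* K`: no translation of `Â` by a section `τ ≠ 1` of `K′` fixes a geometric point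
  (★ `forall_comp_translation_ne_of_forall_restrict_ne`).  Needs NO surjectivity of `λ` and no level structure on `Â`.

Cell `hodgecm-mathlib` (D-0151), HECKE-LINK socket (B), the `hfree′` conjunct of the `hExt` package of ★
`SiegelHeckeQuotientTripleGlue` for the spelling of record `K′ := K.map (IsMonHom.monoidHom λ′ (𝟙_ (Over S)))`.
Count-neutral; HC_CM is proved only modulo the 7 printed citations until rung 0 closes; nothing here is about HC.

## References
* [MumfordAV1970] D. Mumford, *Abelian Varieties* (1970), §7 Thm. 4 (p. 72), §23 (p. 231).
* [MumfordFogartyKirwan1994] D. Mumford, J. Fogarty, F. Kirwan, *GIT* 3rd ed. (1994), Ch. 7 §2 Def. 7.1 (p. 129), App. 7A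
  (pp. 234–235).
* [SGA1] A. Grothendieck, *SGA 1*, Exp. V Prop. 2.6 (i), Déf. 2.7.
-/

noncomputable section

universe u

open CategoryTheory CategoryTheory.Limits AlgebraicGeometry MonoidalCategory CartesianMonoidalCategory
open scoped MonObj

namespace Literature.AlgebraicGeometry.AbelianSchemes

namespace AbelianSchemeOver

variable {S : Scheme.{u}} (A : AbelianSchemeOver S) {D : A.DualPair} (pol : A.Polarization D)
  {g : ℕ} {δ : Fin g → ℕ} {n d : ℕ} (φ : A.LevelStructure g n)
  {K₀ : Set (Fin g ⊕ Fin g → ZMod n)} {K : Subgroup A.Sections}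

/-! ## §1 `λ` is injective on the constant `d`-torsion subgroup `K` -/

/-- **A section `σ ≠ 1` of `K = φ(K₀)` has `(σ ≫ λ)(s̄) ≠ 1` at every geometric point** when `K` is killed by `d` and the
type `δ` of `λ` is prime to `d`: `(σ ≫ λ)(s̄) = σ(s̄) ≫ λ` (★ `restrict_comp`), `σ(s̄)` is `d`-torsion, `λ` is injective on
`d`-torsion geometric fibre points (★ `HasType.eq_one_of_pow_eq_one_of_comp_lam_eq_one`), and `σ(s̄) ≠ 1` (★
`restrict_ne_of_mem_iff`). [cite: MumfordAV1970, §7 Thm. 4 (p. 72) and §23 (p. 231)]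
[cite: MumfordFogartyKirwan1994, Ch. 7 §2 Definition 7.1 (p. 129) and App. 7A (pp. 234–235)] -/
theorem restrict_comp_lam_ne_one_of_mem_iff (hT : pol.HasType δ) (hcop : Nat.Coprime (∏ i, δ i) d)
    (hKr : ∀ σ : A.Sections, σ ∈ K ↔ ∃ c ∈ K₀, φ.section_ c = σ) (hK : ∀ σ : K, (σ : A.Sections) ^ d = 1)
    ⦃Ω : Type u⦄ [Field Ω] [IsAlgClosed Ω] (s : Spec (.of Ω) ⟶ S) {σ : A.Sections} (hσ : σ ∈ K) (hσ1 : σ ≠ 1) :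
    D.hat.restrict s (σ ≫ pol.lam) ≠ 1 := by
  haveI := pol.isMonHom
  intro h
  rw [restrict_comp] at h
  have hd : A.restrict s σ ^ d = 1 := by
    rw [← A.restrict_pow s σ d, hK ⟨σ, hσ⟩]
    exact A.restrict_one s
  have h1 : A.restrict s σ = 1 := hT.eq_one_of_pow_eq_one_of_comp_lam_eq_one hcop s (A.restrict s σ) hd h
  exact φ.restrict_ne_of_mem_iff hKr Ω s σ hσ hσ1 (h1.trans (A.restrict_one s).symm)

/-- **`σ ≫ λ = 1 ⇒ σ = 1` on `K`** as soon as the base has a geometric point `s̄` (read §1 at `s̄`): `σ ↦ σ ≫ λ` is injective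
on the constant `d`-torsion subgroup. [cite: MumfordAV1970, §7 Thm. 4 (p. 72) and §23 (p. 231)]
[cite: MumfordFogartyKirwan1994, Ch. 7 §2 Definition 7.1 (p. 129)] -/
theorem eq_one_of_comp_lam_eq_one_of_mem_iff (hT : pol.HasType δ) (hcop : Nat.Coprime (∏ i, δ i) d)
    (hKr : ∀ σ : A.Sections, σ ∈ K ↔ ∃ c ∈ K₀, φ.section_ c = σ) (hK : ∀ σ : K, (σ : A.Sections) ^ d = 1)
    ⦃Ω : Type u⦄ [Field Ω] [IsAlgClosed Ω] (s : Spec (.of Ω) ⟶ S)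
    {σ : A.Sections} (hσ : σ ∈ K) (h : σ ≫ pol.lam = 1) : σ = 1 := by
  by_contra hσ1
  refine A.restrict_comp_lam_ne_one_of_mem_iff pol φ hT hcop hKr hK s hσ hσ1 ?_
  rw [h]
  exact D.hat.restrict_one s

/-- **`σ ↦ σ ≫ λ` is injective on `K`** (base with a geometric point `s̄`), in Mathlib's `Set.InjOn` currency for the
«`σ ↦ σ ≫ λ`» monoid homomorphism on sections. [cite: MumfordAV1970, §7 Thm. 4 (p. 72) and §23 (p. 231)]
[cite: MumfordFogartyKirwan1994, Ch. 7 §2 Definition 7.1 (p. 129)] -/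
theorem injOn_comp_lam_of_mem_iff (hT : pol.HasType δ) (hcop : Nat.Coprime (∏ i, δ i) d)
    (hKr : ∀ σ : A.Sections, σ ∈ K ↔ ∃ c ∈ K₀, φ.section_ c = σ) (hK : ∀ σ : K, (σ : A.Sections) ^ d = 1)
    ⦃Ω : Type u⦄ [Field Ω] [IsAlgClosed Ω] (s : Spec (.of Ω) ⟶ S) :
    haveI := pol.isMonHom
    Set.InjOn (IsMonHom.monoidHom pol.lam (𝟙_ (Over S))) K := by
  haveI := pol.isMonHom
  intro σ₁ hσ₁ σ₂ hσ₂ h12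
  have hmem : σ₁ * σ₂⁻¹ ∈ K := K.mul_mem hσ₁ (K.inv_mem hσ₂)
  have h1 : IsMonHom.monoidHom pol.lam (𝟙_ (Over S)) (σ₁ * σ₂⁻¹) = 1 := by
    rw [map_mul, map_inv, h12, mul_inv_cancel]
  exact mul_inv_eq_one.1 (A.eq_one_of_comp_lam_eq_one_of_mem_iff pol φ hT hcop hKr hK s hmem h1)

/-- **`|λ_* K| = |K|`** (base with a geometric point `s̄`): the count input «`λ′` injective on `K`» of the D6 package's
`hcard : |K| · |K′| = d^{2g}`. [cite: MumfordAV1970, §7 Thm. 4 (p. 72) and §23 (p. 231)]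
[cite: MumfordFogartyKirwan1994, Ch. 7 §2 Definition 7.1 (p. 129)] -/
theorem natCard_map_lam_eq_of_mem_iff (hT : pol.HasType δ) (hcop : Nat.Coprime (∏ i, δ i) d)
    (hKr : ∀ σ : A.Sections, σ ∈ K ↔ ∃ c ∈ K₀, φ.section_ c = σ) (hK : ∀ σ : K, (σ : A.Sections) ^ d = 1)
    ⦃Ω : Type u⦄ [Field Ω] [IsAlgClosed Ω] (s : Spec (.of Ω) ⟶ S) :
    haveI := pol.isMonHom
    Nat.card (K.map (IsMonHom.monoidHom pol.lam (𝟙_ (Over S)))) = Nat.card K := by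
  haveI := pol.isMonHom
  have hbij : Set.BijOn (IsMonHom.monoidHom pol.lam (𝟙_ (Over S))) (K : Set A.Sections)
      (K.map (IsMonHom.monoidHom pol.lam (𝟙_ (Over S))) : Set D.hat.Sections) :=
    ⟨fun σ hσ => Subgroup.mem_map_of_mem _ hσ, A.injOn_comp_lam_of_mem_iff pol φ hT hcop hKr hK s,
      fun τ hτ => Subgroup.mem_map.1 hτ⟩
  exact (Nat.card_congr hbij.equiv).symm

/-! ## §2 The freeness clause `hfree′` for `K′ := λ_* K` -/

/-- **Points form at the fibres**: a section `τ ≠ 1` of `K′ = λ_* K = K.map (σ ↦ σ ≫ λ)` restricts to a point other than the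
origin in every geometric fibre of `Â`. [cite: MumfordAV1970, §7 Thm. 4 (p. 72) and §23 (p. 231)]
[cite: MumfordFogartyKirwan1994, Ch. 7 §2 Definition 7.1 (p. 129) and App. 7A (pp. 234–235)] -/
theorem restrict_ne_of_mem_map_lam (hT : pol.HasType δ) (hcop : Nat.Coprime (∏ i, δ i) d)
    (hKr : ∀ σ : A.Sections, σ ∈ K ↔ ∃ c ∈ K₀, φ.section_ c = σ) (hK : ∀ σ : K, (σ : A.Sections) ^ d = 1) :
    haveI := pol.isMonHom
    ∀ (Ω : Type u) [Field Ω] [IsAlgClosed Ω] (s : Spec (.of Ω) ⟶ S) (τ : D.hat.Sections),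
      τ ∈ K.map (IsMonHom.monoidHom pol.lam (𝟙_ (Over S))) → τ ≠ 1 → D.hat.restrict s τ ≠ D.hat.restrict s 1 := by
  haveI := pol.isMonHom
  intro Ω _ _ s τ hτ hτ1 h
  obtain ⟨σ, hσ, rfl⟩ := Subgroup.mem_map.1 hτ
  have hσ1 : σ ≠ 1 := by
    rintro rfl
    exact hτ1 (map_one (IsMonHom.monoidHom pol.lam (𝟙_ (Over S))))
  rw [D.hat.restrict_one s] at h
  exact A.restrict_comp_lam_ne_one_of_mem_iff pol φ hT hcop hKr hK s hσ hσ1 h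

/-- **THE FREENESS CLAUSE `hfree′` OF THE (ii)-CHAIN BLOCK FOR `K′ := λ_* K`**: no translation of the dual abelian scheme
`Â` by a section `τ ≠ 1` of `K′ = K.map (σ ↦ σ ≫ λ)` fixes a geometric point of `Â` — for `K = φ(K₀)` killed by `d` and
`λ` of type `δ` with `(∏ δᵢ, d) = 1` (★ `forall_comp_translation_ne_of_forall_restrict_ne`).  No surjectivity of `λ`, no
level structure on `Â` is needed. [cite: SGA1, Exp. V Prop. 2.6 (i), Déf. 2.7] [cite: MumfordAV1970, §7 Thm. 4 (p. 72) and §23 (p. 231)]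
[cite: MumfordFogartyKirwan1994, Ch. 7 §2 Definition 7.1 (p. 129) and App. 7A (pp. 234–235)] -/
theorem translation_ne_of_mem_map_lam (hT : pol.HasType δ) (hcop : Nat.Coprime (∏ i, δ i) d)
    (hKr : ∀ σ : A.Sections, σ ∈ K ↔ ∃ c ∈ K₀, φ.section_ c = σ) (hK : ∀ σ : K, (σ : A.Sections) ^ d = 1) :
    haveI := pol.isMonHom
    ∀ (Ω : Type u) [Field Ω] [IsAlgClosed Ω] (x : Spec (.of Ω) ⟶ D.hat.left)
      (τ : K.map (IsMonHom.monoidHom pol.lam (𝟙_ (Over S)))), τ ≠ 1 →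
      x ≫ (D.hat.translation (τ : D.hat.Sections)).left ≠ x := by
  haveI := pol.isMonHom
  exact D.hat.forall_comp_translation_ne_of_forall_restrict_ne _
    (A.restrict_ne_of_mem_map_lam pol φ hT hcop hKr hK)

/-- The same for any subgroup `K′` CONTAINED in the image `λ_* K` (every element of `K′` is some `σ ≫ λ`, `σ ∈ K`; freeness
descends to subgroups). [cite: SGA1, Exp. V Prop. 2.6 (i), Déf. 2.7] [cite: MumfordAV1970, §7 Thm. 4 (p. 72) and §23 (p. 231)] -/
theorem translation_ne_of_le_map_lam (hT : pol.HasType δ) (hcop : Nat.Coprime (∏ i, δ i) d)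
    (hKr : ∀ σ : A.Sections, σ ∈ K ↔ ∃ c ∈ K₀, φ.section_ c = σ) (hK : ∀ σ : K, (σ : A.Sections) ^ d = 1)
    (K' : Subgroup D.hat.Sections)
    (hK' : haveI := pol.isMonHom; K' ≤ K.map (IsMonHom.monoidHom pol.lam (𝟙_ (Over S)))) :
    ∀ (Ω : Type u) [Field Ω] [IsAlgClosed Ω] (x : Spec (.of Ω) ⟶ D.hat.left) (τ : K'), τ ≠ 1 →
      x ≫ (D.hat.translation (τ : D.hat.Sections)).left ≠ x := by
  haveI := pol.isMonHom
  refine D.hat.forall_comp_translation_ne_of_forall_restrict_ne K' fun Ω _ _ s τ hτ hτ1 => ?_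
  exact A.restrict_ne_of_mem_map_lam pol φ hT hcop hKr hK Ω s τ (hK' hτ) hτ1

end AbelianSchemeOver

end Literature.AlgebraicGeometry.AbelianSchemes

end
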